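import Literature.AlgebraicGeometry.Resolution.StalkBaseChangeChart
import Literature.AlgebraicGeometry.Resolution.SmoothUniformizationProofs
import Mathlib.RingTheory.Ideal.KrullsHeightTheorem
import Mathlib.RingTheory.TensorProduct.Quotient
import HarnessLib

/-!
# F-AQS-T (1′) separable base change in the kernel, (δ2) SQUARE → φ — algebraic core: at a prime over `𝔪` of
# `O ⊗ₖ k'` with the same height, `𝔪` extends to the maximal ideal

Route `ResolutionOfSingularities/WeightedInvariant`, door crux `HypersurfaceCentreConstruction`
(stmt-ResolutionOfSingularities-19897) — OURS, helper; (o25-δ) «`AbramovichQuekSchober2025_separableBaseChange` in the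
kernel» (owner res-D-pv-025 AS stub-10: δ0 p522931, δ1, δ3), piece **(δ2) «SQUARE → φ»** (res-type-047, TAKING
2026-08-27T10:25Z).  This file is the commutative-algebra heart of (δ2): for a Noetherian local `k`-algebra `O`
(`𝒪_{Y,η}`), a field extension `k'/k` that is FORMALLY SMOOTH and ESSENTIALLY OF FINITE TYPE (e.g. `k(ℤʲ)`, finite
separable extensions — not `k^sep`: the general formally smooth case needs «𝔪-smooth Noetherian local over a field
⇒ regular», Matsumura 28.7, not in the tree), `T := O ⊗ₖ k'`, a prime `𝔱 ⊇ 𝔪_O T` and a localization `B` of `T` at `𝔱`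
(`𝒪_{Y′,η′}`) with `dim B = dim O`:

* `map_maximalIdeal_eq_of_ringKrullDim_eq` — **`𝔪_O · B = 𝔪_B`**.  Proof: flat going-down
  (`Ideal.height_eq_height_add_of_liesOver_of_hasGoingDown`): `ht 𝔱 = ht 𝔪_O + ht (𝔱 mod 𝔪_O T)`, and
  `ht 𝔱 = dim B = dim O = ht 𝔪_O`, so the fibre prime has height `0`; the fibre ring `T ⧸ 𝔪_O T ≅ κ(O) ⊗ₖ k'`
  (`Algebra.TensorProduct.quotIdealMapEquivQuotTensor`) is formally smooth and essentially of finite type over the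
  field `κ(O)`, so its localization at the fibre prime is a REGULAR local ring (Literature
  `isRegularLocalRing_of_formallySmooth_of_essFiniteType`, Görtz–Wedhorn 6.26) of dimension `0`, i.e. a field; and
  `B ⧸ 𝔪_O B` is that localization (Mathlib: localization commutes with quotients), so `𝔪_O B` is maximal.

Consumers: the scheme layer of (δ2) (local rings of `Y ×ₖ Spec k'` at points over `η` are such `B`, Literature
`StalkBaseChangeChart`/`stalkTensorChart`), hence `𝔪.map φ = 𝔪′`, regularity of `𝒪_{Y′,η′}` and formal
smoothness of the residue extension for res-D-pv-025's δ1/δ3.  No definitions.  Nothing here is a claim about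
Hironaka's problem or about any manuscript under adjudication; AI-written, weaker than expert review.
-/

noncomputable section

set_option linter.dupNamespace false -- mandated namespace of this single-conjunct summit

namespace Summit.ResolutionOfSingularities.ResolutionOfSingularities.Theorems.AQSBaseChange

universe u

open IsLocalRing TensorProduct Algebra.TensorProduct
open Literature.AlgebraicGeometry.Resolution

/-- **The fibre at a prime over `𝔪` of `O ⊗ₖ k'` is a field when heights agree.**  `O` a Noetherian local
`k`-algebra, `k'/k` a formally smooth field extension essentially of finite type, `T := O ⊗ₖ k'`, `𝔱` a prime of `T`
over `𝔪_O`, `B` a localization of `T` at `𝔱` with `ringKrullDim B = ringKrullDim O` (finite): then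
`𝔪_O · B = 𝔪_B`.  (Flat going-down: `ht 𝔱 = ht 𝔪 + ht(𝔱 mod 𝔪T)`, so the fibre `B/𝔪B` — a localization of
`κ(O) ⊗ₖ k'`, formally smooth and essentially of finite type over `κ(O)`, hence regular — has dimension `0` and is a
field.) [folklore] -/
theorem map_maximalIdeal_eq_of_ringKrullDim_eq {k : Type u} [Field k] {O : Type u} [CommRing O] [IsLocalRing O]
    [IsNoetherianRing O] [Algebra k O] (k' : Type u) [Field k'] [Algebra k k'] [Algebra.FormallySmooth k k']
    [Algebra.EssFiniteType k k'] (𝔱 : Ideal (O ⊗[k] k')) [𝔱.IsPrime]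
    (h𝔱 : (maximalIdeal O).map (algebraMap O (O ⊗[k] k')) ≤ 𝔱)
    (B : Type u) [CommRing B] [IsLocalRing B] [Algebra (O ⊗[k] k') B] [IsLocalization.AtPrime B 𝔱]
    {d : ℕ} (hdO : ringKrullDim O = d) (hdB : ringKrullDim B = d) :
    (maximalIdeal O).map ((algebraMap (O ⊗[k] k') B).comp (algebraMap O (O ⊗[k] k'))) = maximalIdeal B := by
  haveI : IsNoetherianRing (O ⊗[k] k') := Algebra.EssFiniteType.isNoetherianRing O (O ⊗[k] k')
  -- `𝔱` lies over `𝔪`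
  haveI h𝔱over : 𝔱.LiesOver (maximalIdeal O) := ⟨by
    rw [Ideal.under_def]
    refine ((IsLocalRing.maximalIdeal.isMaximal O).eq_of_le ?_ ?_)
    · exact Ideal.IsPrime.ne_top (Ideal.IsPrime.comap _)
    · exact Ideal.map_le_iff_le_comap.mp h𝔱⟩
  -- heights: `ht 𝔱 = ht 𝔪 + ht (𝔱 mod 𝔪T)` by flat going-down, and `ht 𝔱 = dim B = d = dim O = ht 𝔪`
  have hht := Ideal.height_eq_height_add_of_liesOver_of_hasGoingDown (maximalIdeal O) 𝔱
  have h1 : 𝔱.height = d := by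
    have := IsLocalization.AtPrime.ringKrullDim_eq_height 𝔱 B
    rw [hdB] at this; exact_mod_cast this.symm
  have h2 : (maximalIdeal O).height = d := by
    have := IsLocalRing.maximalIdeal_height_eq_ringKrullDim (R := O)
    rw [hdO] at this; exact_mod_cast this
  rw [h1, h2] at hht
  have h0 : (𝔱.map (Ideal.Quotient.mk ((maximalIdeal O).map (algebraMap O (O ⊗[k] k'))))).height = 0 := by
    have h3 : (d : ℕ∞) + (𝔱.map (Ideal.Quotient.mk ((maximalIdeal O).map (algebraMap O (O ⊗[k] k'))))).height
        = (d : ℕ∞) + 0 := by rw [add_zero]; exact hht.symm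
    exact (add_right_inj_of_ne_top (ENat.coe_ne_top d)).mp h3
  -- the fibre ring `T ⧸ 𝔪T`, an algebra over `κ = O ⧸ 𝔪`: formally smooth and essentially of finite type
  set I : Ideal (O ⊗[k] k') := (maximalIdeal O).map (algebraMap O (O ⊗[k] k')) with hI
  have hI𝔱 : I ≤ 𝔱 := h𝔱
  set 𝔱' : Ideal ((O ⊗[k] k') ⧸ I) := 𝔱.map (Ideal.Quotient.mk I) with h𝔱'
  haveI h𝔱'prime : 𝔱'.IsPrime :=
    Ideal.map_isPrime_of_surjective Ideal.Quotient.mk_surjective (by rw [Ideal.mk_ker]; exact hI𝔱)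
  letI : Field (O ⧸ maximalIdeal O) := Ideal.Quotient.field (maximalIdeal O)
  haveI : Algebra.FormallySmooth (O ⧸ maximalIdeal O) ((O ⊗[k] k') ⧸ I) :=
    Algebra.FormallySmooth.of_equiv
      (Algebra.TensorProduct.quotIdealMapEquivQuotTensor (O ⊗[k] k') (maximalIdeal O)).symm
  haveI : Algebra.EssFiniteType (O ⧸ maximalIdeal O) ((O ⊗[k] k') ⧸ I) := inferInstance
  -- its localization at `𝔱'` is a regular local ring of dimension `0`, i.e. a field
  let L := Localization.AtPrime 𝔱'
  haveI : Algebra.EssFiniteType (O ⧸ maximalIdeal O) L := inferInstance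
  haveI : Algebra.FormallySmooth (O ⧸ maximalIdeal O) L := inferInstance
  haveI : IsRegularLocalRing L := isRegularLocalRing_of_formallySmooth_of_essFiniteType (O ⧸ maximalIdeal O) L
  have hdimL : ringKrullDim L = 0 := by
    rw [IsLocalization.AtPrime.ringKrullDim_eq_height 𝔱' L, h0]; rfl
  have hLbot : maximalIdeal L = ⊥ := by
    have h := ‹IsRegularLocalRing L›.spanFinrank_maximalIdeal
    rw [hdimL] at h
    have h' : (maximalIdeal L).spanFinrank = 0 := by exact_mod_cast h
    exact (Submodule.spanFinrank_eq_zero_iff_eq_bot (IsNoetherian.noetherian _)).mp h'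
  have hLfield : IsField L := (IsLocalRing.isField_iff_maximalIdeal_eq).mpr hLbot
  -- `B ⧸ 𝔪B` is (also) the localization of the fibre ring at `𝔱'`
  set J : Ideal B := I.map (algebraMap (O ⊗[k] k') B) with hJ
  have hJeq : (maximalIdeal O).map ((algebraMap (O ⊗[k] k') B).comp (algebraMap O (O ⊗[k] k'))) = J := by
    rw [hJ, hI, Ideal.map_map]
  haveI hlocQ : IsLocalization (Algebra.algebraMapSubmonoid ((O ⊗[k] k') ⧸ I) 𝔱.primeCompl) (B ⧸ J) :=
    inferInstance
  have hsub : Algebra.algebraMapSubmonoid ((O ⊗[k] k') ⧸ I) 𝔱.primeCompl = 𝔱'.primeCompl := by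
    ext x
    constructor
    · rintro ⟨s, hs, rfl⟩ hx
      apply hs
      have hx' : (Ideal.Quotient.mk I s) ∈ 𝔱.map (Ideal.Quotient.mk I) := hx
      rw [Ideal.mem_map_iff_of_surjective _ Ideal.Quotient.mk_surjective] at hx'
      obtain ⟨t, ht, hts⟩ := hx'
      rw [Ideal.Quotient.eq] at hts
      have : s = t - (t - s) := by ring
      rw [this]
      exact 𝔱.sub_mem ht (hI𝔱 hts)
    · intro hx
      obtain ⟨s, rfl⟩ := Ideal.Quotient.mk_surjective x
      exact ⟨s, fun hs => hx (Ideal.mem_map_of_mem _ hs), rfl⟩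
  haveI : IsLocalization.AtPrime (B ⧸ J) 𝔱' := by
    rw [IsLocalization.AtPrime, ← hsub]; exact hlocQ
  -- hence `B ⧸ 𝔪B ≅ L` is a field, `𝔪B` is maximal, and equals `𝔪_B`
  have hfield : IsField (B ⧸ J) :=
    MulEquiv.isField hLfield (IsLocalization.algEquiv 𝔱'.primeCompl (B ⧸ J) L).toMulEquiv
  rw [hJeq]
  exact IsLocalRing.eq_maximalIdeal (Ideal.Quotient.maximal_of_isField J hfield)

end Summit.ResolutionOfSingularities.ResolutionOfSingularities.Theorems.AQSBaseChange

end
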